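/-
Copyright (c) 2026 the pub-hodgecm-mathlib formalisation cell (harness21).  Prover seat hodgecm-mathlib-LH6-p01 (g8): P6b wave C, row Dβ
(Dβ-thm steps (N)(F): rigid descent of a linearisation along `{0} × T`) (desk F0P6b-plan (g14)); box LA-ref2 (g8) ∕ node LH10-p02 (g18), 2026-09-03.
-/
import Literature.AlgebraicGeometry.AbelianSchemes.ProductSliceRigidity
import Literature.AlgebraicGeometry.AbelianSchemes.RigidifiedLineBundleComap
import HarnessLib

/-!
# Rigid descent of a `Z`-linearisation along the slice `{0} × T` of `A ×_S T`, for an abelian scheme `A/S` and a monoid SCHEME `Z`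

Layer `Literature/AlgebraicGeometry/AbelianSchemes`, namespace `Literature.AlgebraicGeometry.AbelianSchemes.AbelianSchemeOver` (+ four naturality lemmas in
`Literature.AlgebraicGeometry.Modules`).  THEOREMS ONLY (no definition, no named fact, no instance, no notation, no `sorry`).  Cell `pub/hodgecm-mathlib` (D-0151),
P6b wave C, row Dβ, steps (N)(F) of (Dβ-thm) (desk F0P6b-plan (g14)); organ capital for §D `stub_L4B1uD_mumfordLambdaDescent` (lane
`--supports stmt-HodgeConjecture-24832`); count-neutral.  HC_CM is proved only modulo the printed citations (2 remaining named inputs hLiu418 =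
`stmt-HodgeConjecture-24832`, h413 = `stmt-HodgeConjecture-24833`) until rung 0 closes; nothing here is about HC.

THE PRINT.  [MumfordAV1970] §13, proof of the Theorem p. 125 (and §8 pp. 78–80 in characteristic `0`): the lift of the action of `K(L)` on the second factor of
`X × X` to `Λ(L)` is NORMALISED along `{0} × X`, and «normalised isomorphisms are unique», whence the cocycle condition holds by rigidity.  The tree has this for a
CONSTANT group (★ `RigidDescentAlongUnitSectionOfBaseChange.exists_equivariantStructure_of_restrictAlong_unitSection_baseChange`, currency ★
`Modules/EquivariantStructure`).  THIS FILE is the group-SCHEME form in the currency of ★ `Modules/SchemeLinearisation` (`Linearisation`, `restrictIso`):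

* §0′ (namespace `…Modules`) naturality of the maps of [MumfordFogartyKirwan1994] Def. 1.6 in a `G`-morphism `f : T ⟶ X` (general monoidal ∕ cartesian-monoidal
  category): `comp_leftUnitor_inv_comp_whiskerRight` (unit slice), `whiskerLeft_comp_mul_whiskerRight` (`μ × 1`), `whiskerLeft_comp_proj₂₃` (`p₂₃`),
  `whiskerLeft_comp_actRight'` (`1 × σ`, needs `[IsModHom G f]`);
* §1 **`exists_linearisation_restrictIso_eq`** — RIGID DESCENT: `A` an abelian scheme over a locally Noetherian `S`, `Z` an `S`-monoid scheme acting on `T` and on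
  `A ×_S T` (ANY `[ModObj]`s) so that the slice `ε × 1_T : T → A ×_S T` is a `Z`-morphism, `E` a line bundle on `A ×_S T` trivial along the slice with
  `σ^* E ≅ p₂^* E` for SOME isomorphism: every `Z`-linearisation `Ψ` of `(ε × 1)^* E` is the restriction of a `Z`-linearisation `Φ` of `E` — `Φ.iso` by normalisation
  (★ `exists_iso_pullback_whiskerLeft_unitSlice_mapIso_eq`), `iso_unit` ∕ `iso_mul` by rigidity (★ `iso_tensor_eq_of_pullback_unitSlice_map_eq`, ★
  `iso_eq_of_pullback_whiskerLeft_unitSlice_map_eq` at `Z′ := Z ⊗ Z`) after rewriting both sides, restricted along the slice, into `compThreeIso` chains around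
  `Ψ.iso_unit` ∕ `Ψ.iso_mul` (★ `Modules/SchemeLinearisation` §1b, ★ `ProductSliceRigidity` §0), which telescope;
  **`linearisation_iso_eq_of_restrictIso_eq`** — and it is UNIQUE: two `Z`-linearisations of `E` with the same restriction along the slice have the same `iso`.

## References
* [MumfordAV1970] D. Mumford, *Abelian Varieties* (1970), §13 (Thm. p. 125 and its proof pp. 125–127); §8 (pp. 78–80).
* [MumfordFogartyKirwan1994] D. Mumford, J. Fogarty, F. Kirwan, *GIT* 3rd ed. (1994), Ch. 1 §3 Def. 1.6 (p. 30).
-/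

set_option autoImplicit false

noncomputable section

-- `Scheme.Modules` / `SheafOfModules` are not reducible; `(A.X ⊗ T).left = (A.baseChange T.hom).X.left` holds by `rfl` only.
set_option backward.isDefEq.respectTransparency false

universe u

open CategoryTheory CategoryTheory.Limits AlgebraicGeometry MonoidalCategory CartesianMonoidalCategory
open scoped MonObj

namespace Literature.AlgebraicGeometry.Modules

/-! ## §0' Naturality of the maps of Def. 1.6 in a `G`-morphism (general monoid object `G`) -/

section Naturality

variable {C : Type*} [Category C] [MonoidalCategory C] {G T X : C} [MonObj G] (f : T ⟶ X)

/-- The unit slice is natural: `f ≫ (1, id_X) = (1, id_T) ≫ (G ◁ f)`. [cite: MumfordFogartyKirwan1994, Ch. 1 §3 Def. 1.6 (p. 30)] -/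
theorem comp_leftUnitor_inv_comp_whiskerRight :
    f ≫ ((λ_ X).inv ≫ η[G] ▷ X) = ((λ_ T).inv ≫ η[G] ▷ T) ≫ G ◁ f := by
  rw [← Category.assoc, leftUnitor_inv_naturality, Category.assoc, Category.assoc, whisker_exchange]

/-- `(G ⊗ G) ◁ f ≫ (μ × 1_X) = (μ × 1_T) ≫ G ◁ f`. [cite: MumfordFogartyKirwan1994, Ch. 1 §3 Def. 1.6 (p. 30)] -/
theorem whiskerLeft_comp_mul_whiskerRight : (G ⊗ G) ◁ f ≫ μ[G] ▷ X = μ[G] ▷ T ≫ G ◁ f :=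
  whisker_exchange _ _

/-- `(G ⊗ G) ◁ f ≫ p₂₃ = p₂₃ ≫ G ◁ f` (in a cartesian monoidal category). [cite: MumfordFogartyKirwan1994, Ch. 1 §3 Def. 1.6 (p. 30)] -/
theorem whiskerLeft_comp_proj₂₃ {D : Type*} [Category D] [CartesianMonoidalCategory D] {G' T' X' : D} [MonObj G'] (f' : T' ⟶ X') :
    (G' ⊗ G') ◁ f' ≫ ((α_ G' G' X').hom ≫ snd G' (G' ⊗ X')) = ((α_ G' G' T').hom ≫ snd G' (G' ⊗ T')) ≫ G' ◁ f' := by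
  rw [← Category.assoc, associator_naturality_right, Category.assoc, whiskerLeft_snd, Category.assoc]

/-- `(G ⊗ G) ◁ f ≫ (1 × σ_X) = (1 × σ_T) ≫ G ◁ f` for a `G`-morphism `f`. [cite: MumfordFogartyKirwan1994, Ch. 1 §3 Def. 1.6 (p. 30)] -/
theorem whiskerLeft_comp_actRight' [ModObj G T] [ModObj G X] [IsModHom G f] :
    (G ⊗ G) ◁ f ≫ ((α_ G G X).hom ≫ G ◁ γ[G, X]) = ((α_ G G T).hom ≫ G ◁ γ[G, T]) ≫ G ◁ f := by
  rw [← Category.assoc, associator_naturality_right, Category.assoc, Category.assoc, ← MonoidalCategory.whiskerLeft_comp,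
    ← MonoidalCategory.whiskerLeft_comp]
  congr 2
  have h := IsModHom.smul_hom (A := G) (f := f)
  exact h.symm

end Naturality

end Literature.AlgebraicGeometry.Modules

namespace Literature.AlgebraicGeometry.AbelianSchemes

open Literature.AlgebraicGeometry.Modules Literature.AlgebraicGeometry.Motives Literature.AlgebraicGeometry.AbelianVarieties
  Literature.AlgebraicGeometry.RelativeSpec

namespace AbelianSchemeOver

/-! ## §1 RIGID DESCENT of a `Z`-linearisation along the slice `{0} × T` of `A ×_S T` -/

section RigidDescent

variable {S : Scheme.{u}} [IsLocallyNoetherian S] (A : AbelianSchemeOver S) {Z : Over S} [MonObj Z] (T : Over S)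
  [τ : ModObj Z T] [σ : ModObj Z (A.X ⊗ T)] [IsModHom Z ((λ_ T).inv ≫ η[A.X] ▷ T)]

/-- **RIGID DESCENT OF A LINEARISATION ALONG `{0} × T`** ([MumfordAV1970] §13 p. 125 / §8 pp. 78–80, scheme-theoretic): let the `S`-monoid scheme `Z` act on `T`
and on `A ×_S T` (ANY actions) so that the slice `ε × 1_T : T → A ×_S T` is a `Z`-morphism; let `E` be a line bundle on `A ×_S T`, trivial along the slice, with
`σ^* E ≅ p₂^* E` for SOME isomorphism on `Z ×_S (A ×_S T)`.  Then every `Z`-linearisation `Ψ` of `(ε × 1)^* E` for the action on `T` is the restriction (★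
`Modules.restrictIso`) of a `Z`-LINEARISATION `Φ` of `E`: `Φ.iso` is the unique isomorphism restricting to `Ψ.iso` (normalisation, ★ `exists_iso_pullback_whiskerLeft_unitSlice_mapIso_eq`),
and its unit and cocycle identities hold because both sides restrict along the slice to the same canonical composites (`Ψ.iso_unit`, `Ψ.iso_mul`, and the pseudofunctor
coherences of ★ `Modules/SchemeLinearisation` §1b), hence agree by rigidity (★ `iso_eq_of_pullback_whiskerLeft_unitSlice_map_eq` with `Z′ = 𝟙` resp. `Z ⊗ Z`).
[cite: MumfordAV1970, §13 Theorem (p. 125) and its proof (pp. 125–127)] [cite: MumfordFogartyKirwan1994, Ch. 1 §3 Def. 1.6 (p. 30)] -/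
theorem exists_linearisation_restrictIso_eq {E : (A.X ⊗ T).left.Modules} (hE : HasRank E 1)
    (hex : Nonempty ((Scheme.Modules.pullback (γ[Z, A.X ⊗ T]).left).obj E ≅ (Scheme.Modules.pullback (snd Z (A.X ⊗ T)).left).obj E))
    (e : (Scheme.Modules.pullback ((λ_ T).inv ≫ η[A.X] ▷ T).left).obj E ≅ SheafOfModules.unit _)
    (Ψ : Linearisation Z T ((Scheme.Modules.pullback ((λ_ T).inv ≫ η[A.X] ▷ T).left).obj E)) :
    ∃ Φ : Linearisation Z (A.X ⊗ T) E, Modules.restrictIso ((λ_ T).inv ≫ η[A.X] ▷ T) E Φ.iso = Ψ.iso := by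
  -- the two squares of the restriction
  have hO1 := act_left_comp_left_of_isModHom (G := Z) ((λ_ T).inv ≫ η[A.X] ▷ T)
  have hO2 := whiskerLeft_left_comp_snd_left (G := Z) (X := A.X ⊗ T) ((λ_ T).inv ≫ η[A.X] ▷ T)
  -- normalise: the unique `φ : σ^* E ≅ p₂^* E` restricting to `Ψ.iso`
  obtain ⟨φ, hφ⟩ := A.exists_iso_pullback_whiskerLeft_unitSlice_mapIso_eq Z T hex
    (RelativeSpec.squareIso hO2 E ≪≫ (Scheme.Modules.pullback (snd Z T).left).mapIso e ≪≫ RigidifiedLineBundle.pullbackUnitIso _)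
    ((RelativeSpec.squareIso hO1 E).symm ≪≫ Ψ.iso ≪≫ (RelativeSpec.squareIso hO2 E).symm)
  refine ⟨⟨φ, ?_, ?_⟩, ?_⟩
  rotate_left 2
  · -- the restriction is `Ψ.iso`
    rw [Modules.restrictIso, hφ]
    ext : 1
    simp
  · -- UNIT: both sides restrict along `ε × 1_T` to the same canonical composite
    apply A.iso_tensor_eq_of_pullback_unitSlice_map_eq T (hasRank_pullback _ (hasRank_pullback _ hE))
    have hsq₀ : ((λ_ T).inv ≫ η[A.X] ▷ T).left ≫ (Modules.unitSlice Z (A.X ⊗ T)).left = (Modules.unitSlice Z T).left ≫ (Z ◁ ((λ_ T).inv ≫ η[A.X] ▷ T)).left := by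
      rw [← Over.comp_left, ← Over.comp_left, Modules.unitSlice, Modules.unitSlice, comp_leftUnitor_inv_comp_whiskerRight]
    have Hu1 : (((λ_ T).inv ≫ η[A.X] ▷ T).left ≫ (Modules.unitSlice Z (A.X ⊗ T)).left) ≫ (γ[Z, A.X ⊗ T]).left = ((λ_ T).inv ≫ η[A.X] ▷ T).left := by rw [Category.assoc, Modules.unitSlice_act_left, Category.comp_id]
    have Hu6 : (((λ_ T).inv ≫ η[A.X] ▷ T).left ≫ (Modules.unitSlice Z (A.X ⊗ T)).left) ≫ (snd Z (A.X ⊗ T)).left = ((λ_ T).inv ≫ η[A.X] ▷ T).left := by rw [Category.assoc, Modules.unitSlice_snd_left, Category.comp_id]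
    have Hu3 : ((Modules.unitSlice Z T).left ≫ (γ[Z, T]).left) ≫ ((λ_ T).inv ≫ η[A.X] ▷ T).left = ((λ_ T).inv ≫ η[A.X] ▷ T).left := by rw [Modules.unitSlice_act_left, Category.id_comp]
    have Hu4 : ((Modules.unitSlice Z T).left ≫ (snd Z T).left) ≫ ((λ_ T).inv ≫ η[A.X] ▷ T).left = ((λ_ T).inv ≫ η[A.X] ▷ T).left := by rw [Modules.unitSlice_snd_left, Category.id_comp]
    have Hu2 : ((Modules.unitSlice Z T).left ≫ (Z ◁ ((λ_ T).inv ≫ η[A.X] ▷ T)).left) ≫ (γ[Z, A.X ⊗ T]).left = ((λ_ T).inv ≫ η[A.X] ▷ T).left := by rw [← hsq₀, Category.assoc, Modules.unitSlice_act_left, Category.comp_id]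
    have Hu5 : ((Modules.unitSlice Z T).left ≫ (Z ◁ ((λ_ T).inv ≫ η[A.X] ▷ T)).left) ≫ (snd Z (A.X ⊗ T)).left = ((λ_ T).inv ≫ η[A.X] ▷ T).left := by rw [← hsq₀, Category.assoc, Modules.unitSlice_snd_left, Category.comp_id]
    -- `ε^* u₀^* φ = sq ≫ u_T^* ((Z ◁ ε)^* φ) ≫ sq⁻¹`
    have nat : (Scheme.Modules.pullback ((λ_ T).inv ≫ η[A.X] ▷ T).left).mapIso ((Scheme.Modules.pullback (Modules.unitSlice Z (A.X ⊗ T)).left).mapIso φ) =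
        RelativeSpec.squareIso hsq₀ _ ≪≫ (Scheme.Modules.pullback (Modules.unitSlice Z T).left).mapIso ((Scheme.Modules.pullback (Z ◁ ((λ_ T).inv ≫ η[A.X] ▷ T)).left).mapIso φ) ≪≫
          (RelativeSpec.squareIso hsq₀ _).symm := by
      ext : 1
      have n := (Iso.eq_comp_inv _).mpr (RelativeSpec.squareIso_hom_naturality hsq₀ φ.hom)
      simpa only [Functor.mapIso_hom, Iso.trans_hom, Iso.symm_hom, Category.assoc] using n
    have key : (Scheme.Modules.pullback ((λ_ T).inv ≫ η[A.X] ▷ T).left).mapIso ((Scheme.Modules.pullback (Modules.unitSlice Z (A.X ⊗ T)).left).mapIso φ) =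
        (Scheme.Modules.pullback ((λ_ T).inv ≫ η[A.X] ▷ T).left).mapIso
          (sectionPullbackIso (Modules.unitSlice_act_left Z (A.X ⊗ T)) E ≪≫ (sectionPullbackIso (Modules.unitSlice_snd_left Z (A.X ⊗ T)) E).symm) := by
      rw [nat, hφ]
      simp only [Functor.mapIso_trans, Functor.mapIso_symm]
      rw [Ψ.iso_unit, squareIso_pullback_obj_eq hsq₀ (γ[Z, A.X ⊗ T]).left Hu1 Hu2 E, squareIso_pullback_obj_eq hsq₀ (snd Z (A.X ⊗ T)).left Hu6 Hu5 E,
        mapIso_squareIso_eq_compThreeIso (Modules.unitSlice Z T).left hO1 Hu3 Hu2 E, mapIso_squareIso_eq_compThreeIso (Modules.unitSlice Z T).left hO2 Hu5 Hu4 E,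
        sectionPullbackIso_pullback_obj_eq (Modules.unitSlice_act_left Z T) ((λ_ T).inv ≫ η[A.X] ▷ T).left Hu3 E,
        sectionPullbackIso_pullback_obj_eq (Modules.unitSlice_snd_left Z T) ((λ_ T).inv ≫ η[A.X] ▷ T).left Hu4 E,
        mapIso_sectionPullbackIso_eq_compThreeIso ((λ_ T).inv ≫ η[A.X] ▷ T).left (Modules.unitSlice_act_left Z (A.X ⊗ T)) Hu1 E,
        mapIso_sectionPullbackIso_eq_compThreeIso ((λ_ T).inv ≫ η[A.X] ▷ T).left (Modules.unitSlice_snd_left Z (A.X ⊗ T)) Hu6 E]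
      ext : 1
      simp
    have key' := congrArg Iso.hom key
    simpa only [Functor.mapIso_hom] using key'
  · -- COCYCLE: both sides restrict along `(Z ⊗ Z) ◁ (ε × 1_T)` to the same composite around `r_T^* Ψ.iso`, `q_T^* Ψ.iso`
    apply A.iso_eq_of_pullback_whiskerLeft_unitSlice_map_eq (Z ⊗ Z) T (hasRank_pullback _ (hasRank_pullback _ hE))
    -- the three squares over the slice
    have hm : ((Z ⊗ Z) ◁ ((λ_ T).inv ≫ η[A.X] ▷ T)).left ≫ (μ[Z] ▷ (A.X ⊗ T)).left = (μ[Z] ▷ T).left ≫ (Z ◁ ((λ_ T).inv ≫ η[A.X] ▷ T)).left := by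
      rw [← Over.comp_left, ← Over.comp_left, whiskerLeft_comp_mul_whiskerRight]
    have hr : ((Z ⊗ Z) ◁ ((λ_ T).inv ≫ η[A.X] ▷ T)).left ≫ (actRight Z (A.X ⊗ T)).left = (actRight Z T).left ≫ (Z ◁ ((λ_ T).inv ≫ η[A.X] ▷ T)).left := by
      rw [← Over.comp_left, ← Over.comp_left, actRight, actRight, whiskerLeft_comp_actRight']
    have hq : ((Z ⊗ Z) ◁ ((λ_ T).inv ≫ η[A.X] ▷ T)).left ≫ (proj₂₃ Z (A.X ⊗ T)).left = (proj₂₃ Z T).left ≫ (Z ◁ ((λ_ T).inv ≫ η[A.X] ▷ T)).left := by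
      rw [← Over.comp_left, ← Over.comp_left, proj₂₃, proj₂₃, whiskerLeft_comp_proj₂₃]
    -- the composites of the three chunks
    have H1a : ((μ[Z] ▷ T).left ≫ (Z ◁ ((λ_ T).inv ≫ η[A.X] ▷ T)).left) ≫ (γ[Z, A.X ⊗ T]).left = ((((Z ⊗ Z) ◁ ((λ_ T).inv ≫ η[A.X] ▷ T)).left ≫ (μ[Z] ▷ (A.X ⊗ T)).left) ≫ (γ[Z, A.X ⊗ T]).left) := by rw [← hm]
    have H1b : ((μ[Z] ▷ T).left ≫ (γ[Z, T]).left) ≫ ((λ_ T).inv ≫ η[A.X] ▷ T).left = ((((Z ⊗ Z) ◁ ((λ_ T).inv ≫ η[A.X] ▷ T)).left ≫ (μ[Z] ▷ (A.X ⊗ T)).left) ≫ (γ[Z, A.X ⊗ T]).left) := by rw [Category.assoc, hO1, ← Category.assoc, ← hm]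
    have H1c : ((actRight Z T).left ≫ (γ[Z, T]).left) ≫ ((λ_ T).inv ≫ η[A.X] ▷ T).left = ((((Z ⊗ Z) ◁ ((λ_ T).inv ≫ η[A.X] ▷ T)).left ≫ (μ[Z] ▷ (A.X ⊗ T)).left) ≫ (γ[Z, A.X ⊗ T]).left) := by rw [← mul_act_left Z T]; exact H1b
    have H1d : (((Z ⊗ Z) ◁ ((λ_ T).inv ≫ η[A.X] ▷ T)).left ≫ (actRight Z (A.X ⊗ T)).left) ≫ (γ[Z, A.X ⊗ T]).left = ((((Z ⊗ Z) ◁ ((λ_ T).inv ≫ η[A.X] ▷ T)).left ≫ (μ[Z] ▷ (A.X ⊗ T)).left) ≫ (γ[Z, A.X ⊗ T]).left) := by rw [Category.assoc, ← mul_act_left Z (A.X ⊗ T), ← Category.assoc]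
    have H1e : ((actRight Z T).left ≫ (Z ◁ ((λ_ T).inv ≫ η[A.X] ▷ T)).left) ≫ (γ[Z, A.X ⊗ T]).left = ((((Z ⊗ Z) ◁ ((λ_ T).inv ≫ η[A.X] ▷ T)).left ≫ (μ[Z] ▷ (A.X ⊗ T)).left) ≫ (γ[Z, A.X ⊗ T]).left) := by rw [← hr]; exact H1d
    have H2a : ((actRight Z T).left ≫ (snd Z T).left) ≫ ((λ_ T).inv ≫ η[A.X] ▷ T).left = (((actRight Z T).left ≫ (snd Z T).left) ≫ ((λ_ T).inv ≫ η[A.X] ▷ T).left) := rfl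
    have H2b : ((proj₂₃ Z T).left ≫ (γ[Z, T]).left) ≫ ((λ_ T).inv ≫ η[A.X] ▷ T).left = (((actRight Z T).left ≫ (snd Z T).left) ≫ ((λ_ T).inv ≫ η[A.X] ▷ T).left) := by rw [← actRight_snd_left Z T]
    have H2c : ((actRight Z T).left ≫ (Z ◁ ((λ_ T).inv ≫ η[A.X] ▷ T)).left) ≫ (snd Z (A.X ⊗ T)).left = (((actRight Z T).left ≫ (snd Z T).left) ≫ ((λ_ T).inv ≫ η[A.X] ▷ T).left) := by rw [Category.assoc, hO2, ← Category.assoc]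
    have H2d : (((Z ⊗ Z) ◁ ((λ_ T).inv ≫ η[A.X] ▷ T)).left ≫ (actRight Z (A.X ⊗ T)).left) ≫ (snd Z (A.X ⊗ T)).left = (((actRight Z T).left ≫ (snd Z T).left) ≫ ((λ_ T).inv ≫ η[A.X] ▷ T).left) := by rw [hr]; exact H2c
    have H2f : ((proj₂₃ Z T).left ≫ (Z ◁ ((λ_ T).inv ≫ η[A.X] ▷ T)).left) ≫ (γ[Z, A.X ⊗ T]).left = (((actRight Z T).left ≫ (snd Z T).left) ≫ ((λ_ T).inv ≫ η[A.X] ▷ T).left) := by rw [Category.assoc, ← hO1, ← Category.assoc]; exact H2b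
    have H2e : (((Z ⊗ Z) ◁ ((λ_ T).inv ≫ η[A.X] ▷ T)).left ≫ (proj₂₃ Z (A.X ⊗ T)).left) ≫ (γ[Z, A.X ⊗ T]).left = (((actRight Z T).left ≫ (snd Z T).left) ≫ ((λ_ T).inv ≫ η[A.X] ▷ T).left) := by rw [hq]; exact H2f
    have H3c : ((μ[Z] ▷ T).left ≫ (Z ◁ ((λ_ T).inv ≫ η[A.X] ▷ T)).left) ≫ (snd Z (A.X ⊗ T)).left = ((((Z ⊗ Z) ◁ ((λ_ T).inv ≫ η[A.X] ▷ T)).left ≫ (μ[Z] ▷ (A.X ⊗ T)).left) ≫ (snd Z (A.X ⊗ T)).left) := by rw [← hm]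
    have H3b : ((μ[Z] ▷ T).left ≫ (snd Z T).left) ≫ ((λ_ T).inv ≫ η[A.X] ▷ T).left = ((((Z ⊗ Z) ◁ ((λ_ T).inv ≫ η[A.X] ▷ T)).left ≫ (μ[Z] ▷ (A.X ⊗ T)).left) ≫ (snd Z (A.X ⊗ T)).left) := by rw [Category.assoc, ← hO2, ← Category.assoc, ← hm]
    have H3a : ((proj₂₃ Z T).left ≫ (snd Z T).left) ≫ ((λ_ T).inv ≫ η[A.X] ▷ T).left = ((((Z ⊗ Z) ◁ ((λ_ T).inv ≫ η[A.X] ▷ T)).left ≫ (μ[Z] ▷ (A.X ⊗ T)).left) ≫ (snd Z (A.X ⊗ T)).left) := by rw [proj₂₃_snd_left Z T]; exact H3b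
    have H3d : ((proj₂₃ Z T).left ≫ (Z ◁ ((λ_ T).inv ≫ η[A.X] ▷ T)).left) ≫ (snd Z (A.X ⊗ T)).left = ((((Z ⊗ Z) ◁ ((λ_ T).inv ≫ η[A.X] ▷ T)).left ≫ (μ[Z] ▷ (A.X ⊗ T)).left) ≫ (snd Z (A.X ⊗ T)).left) := by rw [Category.assoc, hO2, ← Category.assoc]; exact H3a
    have H3e : (((Z ⊗ Z) ◁ ((λ_ T).inv ≫ η[A.X] ▷ T)).left ≫ (proj₂₃ Z (A.X ⊗ T)).left) ≫ (snd Z (A.X ⊗ T)).left = ((((Z ⊗ Z) ◁ ((λ_ T).inv ≫ η[A.X] ▷ T)).left ≫ (μ[Z] ▷ (A.X ⊗ T)).left) ≫ (snd Z (A.X ⊗ T)).left) := by rw [Category.assoc, proj₂₃_snd_left Z (A.X ⊗ T), ← Category.assoc]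
    -- naturality of the three pullbacks of `φ` along the slice squares
    have natm : (Scheme.Modules.pullback ((Z ⊗ Z) ◁ ((λ_ T).inv ≫ η[A.X] ▷ T)).left).mapIso ((Scheme.Modules.pullback (μ[Z] ▷ (A.X ⊗ T)).left).mapIso φ) =
        RelativeSpec.squareIso hm _ ≪≫ (Scheme.Modules.pullback (μ[Z] ▷ T).left).mapIso ((Scheme.Modules.pullback (Z ◁ ((λ_ T).inv ≫ η[A.X] ▷ T)).left).mapIso φ) ≪≫
          (RelativeSpec.squareIso hm _).symm := by
      ext : 1
      have n := (Iso.eq_comp_inv _).mpr (RelativeSpec.squareIso_hom_naturality hm φ.hom)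
      simpa only [Functor.mapIso_hom, Iso.trans_hom, Iso.symm_hom, Category.assoc] using n
    have natr : (Scheme.Modules.pullback ((Z ⊗ Z) ◁ ((λ_ T).inv ≫ η[A.X] ▷ T)).left).mapIso ((Scheme.Modules.pullback (actRight Z (A.X ⊗ T)).left).mapIso φ) =
        RelativeSpec.squareIso hr _ ≪≫ (Scheme.Modules.pullback (actRight Z T).left).mapIso ((Scheme.Modules.pullback (Z ◁ ((λ_ T).inv ≫ η[A.X] ▷ T)).left).mapIso φ) ≪≫
          (RelativeSpec.squareIso hr _).symm := by
      ext : 1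
      have n := (Iso.eq_comp_inv _).mpr (RelativeSpec.squareIso_hom_naturality hr φ.hom)
      simpa only [Functor.mapIso_hom, Iso.trans_hom, Iso.symm_hom, Category.assoc] using n
    have natq : (Scheme.Modules.pullback ((Z ⊗ Z) ◁ ((λ_ T).inv ≫ η[A.X] ▷ T)).left).mapIso ((Scheme.Modules.pullback (proj₂₃ Z (A.X ⊗ T)).left).mapIso φ) =
        RelativeSpec.squareIso hq _ ≪≫ (Scheme.Modules.pullback (proj₂₃ Z T).left).mapIso ((Scheme.Modules.pullback (Z ◁ ((λ_ T).inv ≫ η[A.X] ▷ T)).left).mapIso φ) ≪≫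
          (RelativeSpec.squareIso hq _).symm := by
      ext : 1
      have n := (Iso.eq_comp_inv _).mpr (RelativeSpec.squareIso_hom_naturality hq φ.hom)
      simpa only [Functor.mapIso_hom, Iso.trans_hom, Iso.symm_hom, Category.assoc] using n
    have key : (Scheme.Modules.pullback ((Z ⊗ Z) ◁ ((λ_ T).inv ≫ η[A.X] ▷ T)).left).mapIso ((Scheme.Modules.pullback (μ[Z] ▷ (A.X ⊗ T)).left).mapIso φ) =
        (Scheme.Modules.pullback ((Z ⊗ Z) ◁ ((λ_ T).inv ≫ η[A.X] ▷ T)).left).mapIso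
          (RelativeSpec.squareIso (mul_act_left Z (A.X ⊗ T)) E ≪≫ (Scheme.Modules.pullback (actRight Z (A.X ⊗ T)).left).mapIso φ ≪≫
            RelativeSpec.squareIso (actRight_snd_left Z (A.X ⊗ T)) E ≪≫ (Scheme.Modules.pullback (proj₂₃ Z (A.X ⊗ T)).left).mapIso φ ≪≫
              RelativeSpec.squareIso (proj₂₃_snd_left Z (A.X ⊗ T)) E) := by
      simp only [Functor.mapIso_trans]
      rw [natm, natr, natq, hφ]
      simp only [Functor.mapIso_trans, Functor.mapIso_symm]
      rw [Ψ.iso_mul]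
      rw [squareIso_pullback_obj_eq hm (γ[Z, A.X ⊗ T]).left rfl H1a E, squareIso_pullback_obj_eq hm (snd Z (A.X ⊗ T)).left rfl H3c E,
        mapIso_squareIso_eq_compThreeIso (μ[Z] ▷ T).left hO1 H1b H1a E, mapIso_squareIso_eq_compThreeIso (μ[Z] ▷ T).left hO2 H3c H3b E,
        squareIso_pullback_obj_eq (mul_act_left Z T) ((λ_ T).inv ≫ η[A.X] ▷ T).left H1b H1c E,
        squareIso_pullback_obj_eq (actRight_snd_left Z T) ((λ_ T).inv ≫ η[A.X] ▷ T).left H2a H2b E,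
        squareIso_pullback_obj_eq (proj₂₃_snd_left Z T) ((λ_ T).inv ≫ η[A.X] ▷ T).left H3a H3b E,
        mapIso_squareIso_eq_compThreeIso ((Z ⊗ Z) ◁ ((λ_ T).inv ≫ η[A.X] ▷ T)).left (mul_act_left Z (A.X ⊗ T)) rfl H1d E,
        squareIso_pullback_obj_eq hr (γ[Z, A.X ⊗ T]).left H1d H1e E, squareIso_pullback_obj_eq hr (snd Z (A.X ⊗ T)).left H2d H2c E,
        mapIso_squareIso_eq_compThreeIso (actRight Z T).left hO1 H1c H1e E, mapIso_squareIso_eq_compThreeIso (actRight Z T).left hO2 H2c H2a E,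
        mapIso_squareIso_eq_compThreeIso ((Z ⊗ Z) ◁ ((λ_ T).inv ≫ η[A.X] ▷ T)).left (actRight_snd_left Z (A.X ⊗ T)) H2d H2e E,
        squareIso_pullback_obj_eq hq (γ[Z, A.X ⊗ T]).left H2e H2f E, squareIso_pullback_obj_eq hq (snd Z (A.X ⊗ T)).left H3e H3d E,
        mapIso_squareIso_eq_compThreeIso (proj₂₃ Z T).left hO1 H2b H2f E, mapIso_squareIso_eq_compThreeIso (proj₂₃ Z T).left hO2 H3d H3a E,
        mapIso_squareIso_eq_compThreeIso ((Z ⊗ Z) ◁ ((λ_ T).inv ≫ η[A.X] ▷ T)).left (proj₂₃_snd_left Z (A.X ⊗ T)) H3e rfl E]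
      ext : 1
      simp
    have key' := congrArg Iso.hom key
    simpa only [Functor.mapIso_hom] using key'

/-- **UNIQUENESS of the rigid descent**: two `Z`-linearisations of `E` (source of rank one) on `A ×_S T` whose structure isomorphisms have the same restriction along
the slice `ε × 1_T` (★ `Modules.restrictIso`) have the SAME structure isomorphism ([MumfordAV1970] §13 p. 125 «normalised isomorphisms are unique»; ★
`iso_eq_of_pullback_whiskerLeft_unitSlice_map_eq` at `Z′ := Z`). [cite: MumfordAV1970, §13 Theorem (p. 125) and its proof (pp. 125–127)] -/
theorem linearisation_iso_eq_of_restrictIso_eq {E : (A.X ⊗ T).left.Modules} (hE : HasRank E 1) (Φ Φ' : Linearisation Z (A.X ⊗ T) E)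
    (h : Modules.restrictIso ((λ_ T).inv ≫ η[A.X] ▷ T) E Φ.iso = Modules.restrictIso ((λ_ T).inv ≫ η[A.X] ▷ T) E Φ'.iso) : Φ.iso = Φ'.iso := by
  refine A.iso_eq_of_pullback_whiskerLeft_unitSlice_map_eq Z T (hasRank_pullback _ hE) _ _ ?_
  have h' := congrArg Iso.hom h
  simp only [Modules.restrictIso, Iso.trans_hom, Functor.mapIso_hom] at h'
  rw [← cancel_mono (RelativeSpec.squareIso (whiskerLeft_left_comp_snd_left (G := Z) (X := A.X ⊗ T) ((λ_ T).inv ≫ η[A.X] ▷ T)) E).hom,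
    ← cancel_epi (RelativeSpec.squareIso (act_left_comp_left_of_isModHom (G := Z) ((λ_ T).inv ≫ η[A.X] ▷ T)) E).hom]
  exact h'

end RigidDescent

end AbelianSchemeOver

end Literature.AlgebraicGeometry.AbelianSchemes

end
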